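import Literature.MathematicalPhysics.KineticTheory.HardSphereEulerLLN

/-!
# Statics of the pinned density `rhoLim`: the `O(σ³)` sup-norm rate and unit mass

Negative-side structure for the crux `ImplosionDichotomy.PolynomialCompression` (stmt-AtomisticToContinuum-12587),
from the standing disprover's `Cruxes/PolynomialCompression/Disproof.lean` §3 (cycles 2–3). By
`Negative/PdeForm.lean` the initial density of EVERY admissible classical solution is the tree's explicit cluster
series `rhoLim P σ x = Σ_j γ_{j+1}(σ) R(σ)^{j+1} β(x)^{j+1}` (`P = profileOf a₀`, `β = a₀/∫a₀`, `HardSphereEulerLLN`);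
these are its quantitative statics under the tree's smallness package `SmallDensity P σ` (all small `σ`), i.e. the
`k = 0` case of input I2 ("quantitative smooth statics", rate `q = 3`) of every line on the crux:
* `abs_rhoLim_sub_ratioLimit_mul_le : |rhoLim − R β| ≤ 2eMθ/(1−θ)` (the `j ≥ 1` tail; `θ = geomRatio P σ = 2eMv₁σ³`);
* `abs_ratioLimit_sub_one_le : |R − 1| ≤ 2eθ/(1−θ)` (from `R F(R) = 1`, `|F(R) − 1| ≤ eθ/(1−θ)`, `R ≤ 2`);
* `abs_rhoLim_sub_β_le : |rhoLim − β| ≤ 16 e² v₁ M² σ³` — the `O(σ³)` SUP-NORM RATE;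
* `integral_rhoLim_eq_one : ∫ rhoLim = 1` — unit mass (`I(1) = R F(R) = 1`).
Higher `C^k` rates (the lines' `SmoothStatics` / `SmoothLocalGibbsStatics` stubs): `rhoLim P σ = g_σ ∘ β` with the scalar
power series `g_σ(b) = Σ_j γ_{j+1}R^{j+1}b^{j+1}`, `|γ_{j+1}R^{j+1}| ≤ 2e(2ev₁σ³)ʲ` (`abs_clusterCoeff_le`, `R ≤ 2`), radius
`≥ (2ev₁σ³)⁻¹ → ∞`, so `‖g_σ − R·id‖_{C^k[0,M]} = O_k(σ³)` and the `C^k` closeness for smooth `β` is Faà di Bruno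
bookkeeping — not done here. refuter-cdisprove-stmt-AtomisticToContinuum-12587-g3-0.
-/

noncomputable section

namespace Summit.AtomisticToContinuum.HydrodynamicLimit.Theorems

open MeasureTheory Filter Set Topology
open Literature.MathematicalPhysics.KineticTheory

namespace PolynomialCompressionStatics

/-- **Closeness to `R β`**: `|rhoLim P σ x - R β(x)| ≤ 2eMθ/(1-θ)` (the `j ≥ 1` tail of the cluster series).
[folklore] -/
theorem abs_rhoLim_sub_ratioLimit_mul_le {P : DensityProfile} {σ : ℝ} (h : SmallDensity P σ) (x : T3) :
    |rhoLim P σ x - ratioLimit P σ * P.β x| ≤ 2 * Real.exp 1 * P.M * geomRatio P σ / (1 - geomRatio P σ) := by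
  have hθ0 := h.geomRatio_nonneg
  have hsplit := (h.summable_rhoLim x).tsum_eq_zero_add
  have h0 : clusterCoeff σ 0 * ratioLimit P σ ^ (0 + 1) * P.β x ^ (0 + 1) = ratioLimit P σ * P.β x := by
    have : clusterCoeff σ 0 = 1 := by
      have h1 := coefLim_one_zero (P := P) h.σ_pos
      rw [coefLim] at h1
      simpa [P.integral_eq_one] using h1
    rw [this]; ring
  have hgeo : HasSum (fun j : ℕ => 2 * Real.exp 1 * P.M * geomRatio P σ ^ (j + 1))
      (2 * Real.exp 1 * P.M * geomRatio P σ / (1 - geomRatio P σ)) := by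
    have h' := (hasSum_geometric_of_lt_one hθ0 h.geomRatio_lt_one).mul_left (2 * Real.exp 1 * P.M * geomRatio P σ)
    rw [div_eq_mul_inv]
    refine h'.congr_fun fun j => ?_
    rw [pow_succ]; ring
  have htail : |∑' j, clusterCoeff σ (j + 1) * ratioLimit P σ ^ (j + 1 + 1) * P.β x ^ (j + 1 + 1)| ≤
      2 * Real.exp 1 * P.M * geomRatio P σ / (1 - geomRatio P σ) := by
    refine (Real.norm_eq_abs _).symm.trans_le (tsum_of_norm_bounded hgeo fun j => ?_)
    exact (Real.norm_eq_abs _).trans_le (h.abs_rhoLim_term_le (j + 1) x)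
  have heq : rhoLim P σ x - ratioLimit P σ * P.β x =
      ∑' j, clusterCoeff σ (j + 1) * ratioLimit P σ ^ (j + 1 + 1) * P.β x ^ (j + 1 + 1) := by
    rw [rhoLim, hsplit, h0]; ring
  rw [heq]
  exact htail

/-- **The limit ratio is `1 + O(σ³)`**: `|R - 1| ≤ 2 · eθ/(1-θ)` (from `R F(R) = 1`, `|F(R) - 1| ≤ eθ/(1-θ)` and
`R ≤ 2`). [folklore] -/
theorem abs_ratioLimit_sub_one_le {P : DensityProfile} {σ : ℝ} (h : SmallDensity P σ) :
    |ratioLimit P σ - 1| ≤ 2 * (Real.exp 1 * geomRatio P σ / (1 - geomRatio P σ)) := by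
  have hF := abs_ratioSeries_sub_one_le (P := P) h.σ_pos h.σ_lt_half h.geomRatio_lt_one h.abs_ratioLimit_le
  have hspec := (ratioLimit_spec (P := P) h.σ_pos h.σ_lt_half h.geomRatio_lt_one h.phi_lt_half).2
  have hR0 := h.ratioLimit_pos
  have hR2 := h.ratioLimit_mem.2
  have heq : ratioLimit P σ - 1 = ratioLimit P σ * (1 - ratioSeries P σ (ratioLimit P σ)) := by
    rw [mul_sub, mul_one, hspec]
  rw [heq, abs_mul, abs_of_pos hR0, abs_sub_comm]
  exact mul_le_mul hR2 hF (abs_nonneg _) zero_le_two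

/-- **The `O(σ³)` sup-norm statics rate**: `|rhoLim P σ x - β(x)| ≤ 16 e² v₁ M² σ³` under `SmallDensity P σ`
(`θ = 2e M v₁ σ³`, `1/(1-θ) < 2`). Input I2 of the shadowing mechanism at order `k = 0`. [folklore] -/
theorem abs_rhoLim_sub_β_le {P : DensityProfile} {σ : ℝ} (h : SmallDensity P σ) (x : T3) :
    |rhoLim P σ x - P.β x| ≤ 16 * Real.exp 1 ^ 2 * v₁ * P.M ^ 2 * σ ^ 3 := by
  have h1 := abs_rhoLim_sub_ratioLimit_mul_le h x
  have h2 := abs_ratioLimit_sub_one_le h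
  have hθ1 := h.geomRatio_lt_one
  have hθ0 := h.geomRatio_nonneg
  have hφ := h.phi_lt_half
  have hM := P.M_pos
  have hβ0 := (P.pos x).le
  have hβM := P.le_M x
  have he : 0 < Real.exp 1 := Real.exp_pos 1
  set θ' := geomRatio P σ with hθ'
  set φ := Real.exp 1 * θ' / (1 - θ') with hφdef
  have hφ0 : 0 ≤ φ := div_nonneg (mul_nonneg he.le hθ0) (sub_pos.2 hθ1).le
  have hstep : |rhoLim P σ x - P.β x| ≤ 4 * P.M * φ := by
    have htri : |rhoLim P σ x - P.β x| ≤
        |rhoLim P σ x - ratioLimit P σ * P.β x| + |ratioLimit P σ - 1| * P.β x := by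
      have e : rhoLim P σ x - P.β x =
          (rhoLim P σ x - ratioLimit P σ * P.β x) + (ratioLimit P σ - 1) * P.β x := by ring
      rw [e]
      refine (abs_add_le _ _).trans ?_
      rw [abs_mul, abs_of_nonneg hβ0]
    have hA : |rhoLim P σ x - ratioLimit P σ * P.β x| ≤ 2 * P.M * φ := by
      refine h1.trans (le_of_eq ?_)
      rw [hφdef]; ring
    have hB : |ratioLimit P σ - 1| * P.β x ≤ 2 * φ * P.M := mul_le_mul h2 hβM hβ0 (by positivity)
    linarith
  have h1θ : 1 / 2 < 1 - θ' := by
    have hθe : θ' ≤ Real.exp 1 * θ' := le_mul_of_one_le_left hθ0 (by have := Real.add_one_le_exp (1 : ℝ); linarith)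
    have hlt : θ' / (1 - θ') < 1 / 2 := lt_of_le_of_lt (div_le_div_of_nonneg_right hθe (sub_pos.2 hθ1).le) hφ
    rw [div_lt_iff₀ (sub_pos.2 hθ1)] at hlt
    linarith
  have hφle : φ ≤ 2 * Real.exp 1 * θ' := by
    rw [hφdef, div_le_iff₀ (sub_pos.2 hθ1)]
    have hmul : Real.exp 1 * θ' * (1 / 2) ≤ Real.exp 1 * θ' * (1 - θ') :=
      mul_le_mul_of_nonneg_left h1θ.le (mul_nonneg he.le hθ0)
    linarith
  have hθeq : θ' = 2 * Real.exp 1 * (P.M * v₁ * σ ^ 3) := by rw [hθ', geomRatio, ovDensity]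
  calc |rhoLim P σ x - P.β x| ≤ 4 * P.M * φ := hstep
    _ ≤ 4 * P.M * (2 * Real.exp 1 * θ') := by gcongr
    _ = 16 * Real.exp 1 ^ 2 * v₁ * P.M ^ 2 * σ ^ 3 := by rw [hθeq]; ring

/-- **Unit mass of the pinned density**: `∫ rhoLim P σ = 1` (in the series, `I(1) = R F(R) = 1`). [folklore] -/
theorem integral_rhoLim_eq_one {P : DensityProfile} {σ : ℝ} (h : SmallDensity P σ) : ∫ y, rhoLim P σ y = 1 := by
  have h1 := h.Ilim_eq_integral (χ := fun _ => (1 : ℝ)) continuous_const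
  simp only [one_mul] at h1
  rw [← h1, Ilim]
  have hR := (ratioLimit_spec (P := P) h.σ_pos h.σ_lt_half h.geomRatio_lt_one h.phi_lt_half).2
  rw [ratioSeries] at hR
  have e : ∑' j, coefLim P σ (fun _ => 1) j * ratioLimit P σ ^ (j + 1) =
      ratioLimit P σ * ∑' j, coefLim P σ (fun _ => 1) j * ratioLimit P σ ^ j := by
    rw [← tsum_mul_left]
    exact tsum_congr fun j => by ring
  rw [e, hR]

end PolynomialCompressionStatics

end Summit.AtomisticToContinuum.HydrodynamicLimit.Theorems

end
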